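import Mathlib

/-!
# Crux `OneStepBackwardContraction` (stmt-QuantumFields-27939, route `BackwardLiouvilleRigidity` rev 3, planner seat ym-r3-idea-1 g6), registered BC3
# skeleton `Cruxes/FluctuationComparisonRegPrIntL/Lines/backward_liouville_rigidity.lean`: the registered stub `stub_potentialForm` (S, pure real algebra)
# LANDED — a two-component one-step bound with contraction `λ < 1` and a floor folds into the ONE-POTENTIAL form `V = a + θ·w`

Width seat ym-line-sfw-p2-w2 g20 (cell `ym-idea-1`, free hands), `--supports stmt-QuantumFields-27939`.  The other registered stub `stub_twoComponentStep`
(XL, the analytic content: Bałaban's small-field inductive step run for the difference of two class trajectories) stays OPEN; the composition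
`OneStepBackwardContraction_of h2 hP` of the skeleton reads this file's theorem as `hP` by name and signature.

THE ALGEBRA.  Given `0 ≤ λ < 1`, `C ≥ 0` put `θ := C/(1 − λ) + 1 ≥ 1`, `C' := C`.  If `a' ≤ (1+e)a + C w + C a² + d` and
`w' ≤ λ w + e a + C (a+w) w + d` (all quantities `≥ 0`), then
`a' + θ w' ≤ a + (θ+1) e a + (C + θλ) w + C a² + θ C (a + w) w + (θ+1) d`, and `C + θλ ≤ θ` (as `θ(1−λ) = C + (1 − λ) ≥ C`),
`(θ+1) e a ≤ (θ+1) e (a + θw)`, `C a² + θ C a w + θ C w² ≤ C (a + θw)²` (`θ ≤ θ²`), so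
`a' + θ w' ≤ (1 + (θ+1) e + C (a + θw)) (a + θw) + (θ+1) d`.

HONEST FRAMING.  Elementary real algebra; nothing of Bałaban's is asserted; crux 27939, the rung `YM3TorusSU2` (RECORD rung) and every mass-gap
statement stay OPEN.  No `def`, no `sorry`.
-/

namespace Summit.QuantumFields.YangMills.Theorems.BackwardLiouvilleRigidity

/-- ★ The registered stub `stub_potentialForm` of the BC3 skeleton of crux `OneStepBackwardContraction` (stmt-QuantumFields-27939): two-component
one-step bounds with contraction `λ < 1`, rate `e`, quadratic constant `C` and floor `d` fold into the one-potential bound for `V = a + θ w` with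
`θ = C/(1−λ) + 1`, `C' = C`, rate `(θ+1) e`, floor `(θ+1) d`. [folklore] -/
theorem stub_potentialForm :
    ∀ (lam C : ℝ), 0 ≤ lam → lam < 1 → 0 ≤ C → ∃ θ C' : ℝ, 1 ≤ θ ∧ 0 ≤ C' ∧ ∀ (e d a w a' w' : ℝ), 0 ≤ e → 0 ≤ d → 0 ≤ a → 0 ≤ w →
      0 ≤ a' → 0 ≤ w' → a' ≤ (1 + e) * a + C * w + C * a ^ 2 + d → w' ≤ lam * w + e * a + C * (a + w) * w + d →
        a' + θ * w' ≤ (1 + (θ + 1) * e + C' * (a + θ * w)) * (a + θ * w) + (θ + 1) * d := by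
  intro lam C hlam0 hlam1 hC
  have h1l : 0 < 1 - lam := by linarith
  refine ⟨C / (1 - lam) + 1, C, ?_, hC, fun e d a w a' w' he hd ha hw _ _ hA hW => ?_⟩
  · have : 0 ≤ C / (1 - lam) := div_nonneg hC h1l.le
    linarith
  set θ : ℝ := C / (1 - lam) + 1 with hθ
  have hθ1 : 1 ≤ θ := by
    have : 0 ≤ C / (1 - lam) := div_nonneg hC h1l.le
    rw [hθ]; linarith
  have hθ0 : 0 ≤ θ := zero_le_one.trans hθ1
  -- `C + θ λ ≤ θ`: `θ (1 − λ) = C + (1 − λ) ≥ C`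
  have hkey : C + θ * lam ≤ θ := by
    have hprod : θ * (1 - lam) = C + (1 - lam) := by
      rw [hθ, add_mul, div_mul_cancel₀ C h1l.ne', one_mul]
    nlinarith
  -- combine the two component bounds with weight `θ ≥ 0`
  have hsum : a' + θ * w' ≤ ((1 + e) * a + C * w + C * a ^ 2 + d) + θ * (lam * w + e * a + C * (a + w) * w + d) :=
    add_le_add hA (mul_le_mul_of_nonneg_left hW hθ0)
  -- the linear `w`-coefficient `C + θλ ≤ θ`, the rate term and the quadratic terms
  have hlin : (C + θ * lam) * w ≤ θ * w := mul_le_mul_of_nonneg_right hkey hw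
  have hrate : (θ + 1) * e * a ≤ (θ + 1) * e * (a + θ * w) := by
    have : 0 ≤ (θ + 1) * e := by positivity
    nlinarith [mul_nonneg hθ0 hw]
  have hquad : C * a ^ 2 + θ * C * (a + w) * w ≤ C * (a + θ * w) ^ 2 := by
    have h1 : θ * C * a * w ≤ 2 * θ * C * a * w := by
      have : 0 ≤ θ * C * a * w := by positivity
      linarith
    have h2 : θ * C * w ^ 2 ≤ θ ^ 2 * C * w ^ 2 := by
      have hθθ : θ ≤ θ ^ 2 := by nlinarith
      have : 0 ≤ C * w ^ 2 := by positivity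
      nlinarith
    nlinarith
  calc a' + θ * w'
      ≤ ((1 + e) * a + C * w + C * a ^ 2 + d) + θ * (lam * w + e * a + C * (a + w) * w + d) := hsum
    _ = a + (θ + 1) * e * a + (C + θ * lam) * w + (C * a ^ 2 + θ * C * (a + w) * w) + (θ + 1) * d := by ring
    _ ≤ a + (θ + 1) * e * (a + θ * w) + θ * w + C * (a + θ * w) ^ 2 + (θ + 1) * d := by linarith
    _ = (1 + (θ + 1) * e + C * (a + θ * w)) * (a + θ * w) + (θ + 1) * d := by ring

end Summit.QuantumFields.YangMills.Theorems.BackwardLiouvilleRigidity
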